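import Mathlib
import HarnessLib.Audit
import Summits.PneNP.PneNP.Theorems.PstarGSystemFreeVar
import Summits.PneNP.PneNP.Theorems.PstarChordReadsMirror

/-!
# The CHORD-READ LEMMA: a monomial-free chord of a terminal core is slice-degenerate (ROUND-24, O1 at exact tightness; `TerminalPeelable`)

FRONTIER range-avoidance ladder, rung F-N3, ROUND 24 (cell `pnp-ideate`, planner memo `r24/CORE-BOUND-NOTES.md` §7 G1 / §14.7, prover-2 memo
`g19/O1-CHORD-READ.md` §2–§3 and §6.6; typed target `PstarCoreBoundTargets.TerminalPeelable` (p646951); restricted-model proof complexity —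
nothing here bears on `P` versus `NP`).

SETTING.  A terminal core `J₀` (`Terminal`: (T3) `J₀ ∧ Γ₁ ∧ Γ₂` unsolvable, (M0) `J₀ ∖ f ∧ Γ₁ ∧ Γ₂` solvable for every `f ∈ J₀`) and a CHORD
`c ∈ J₀` with XOR pair `a, b = vars c 0, vars c 1` and private AND pair `p, q = vars c 2, vars c 3`, MONOMIAL-FREE: no monomial output of
`Γ₁, Γ₂` touches `p` or `q` (at exact tightness `2·#bdry J₀ = 3·#J₀` this is the reader class LIN of the memo).  The SLICES of `c` are
`H_t = Sol(J₀ ∖ c) ∩ {x_a ⊕ x_b = t}` (`t = y_c`: the sub-varieties `V1, V4` of the memo; `t = ¬y_c`: `V3`).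

* `SliceGeneric I y J₀ c 𝒢` — the ONE structure-dependent input (memo §3 "GENERICITY", §5): every G-constraint with monomials from the menu `𝒢`
  and not reading `p, q` that misses a target on a whole slice `H_t` is a function of `x_a ⊕ x_b` alone (the instance form of "the linear
  functionals vanishing on `φ̃(V)` are the evident ones").  NOT provable from expansion: it fails at the triangle-closing chord of the 110
  degenerate `k = 12` structures and in the bowtie (memo §6.1, §6.7); certified numerically per structure and fibre class for the 1800 tight
  `k = 12` O1 structures in class LIN (kit j314774, §6.6: at least five of the six chords of every structure are generic for every `y`).
* `ChordLocal I c C G` — the reader `(C, G)` is a function of `(x_a ⊕ x_b, x_p, x_q)` alone.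
* `chordLocal_of_fail_slice` — SLICE LEMMA: a reader (monomials in `𝒢`, avoiding `p, q`) that fails on `Sol(J₀) ∩ {x_p = π, x_q = κ}` is chord-local
  (set the privates, `PstarChordReadsMirror.solves_set_privates`; split them off the linear part; apply `SliceGeneric` on `H_{y_c ⊕ πκ}`).
* `false_of_chordLocal` — ENDGAME: two chord-local readers contradict (T3): the (M0) witness of another output `f ≠ c` satisfies the equation of
  `c`, and `gSat` (`PstarGSat`) supplies a solution of `J₀ ∖ c` with the same `x_a ⊕ x_b`, whose privates we set to the witness's.
* `false_of_fail₂` / `false_of_fail₁` / `false_of_iff` — the three KILLS: a reader failing on a slice, or the two readers complementary on a slice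
  (then the SUM reader `(C₁ ∆ C₂, G₁ ∆ G₂)` fails there), forces both readers chord-local (via (T3) on a slice where the local one holds — or, if
  it holds on no slice, (M0) fails at once).
* `false_of_monomial_free_chord` — **THE CHORD-READ LEMMA**: `Terminal`, `c` a monomial-free chord, `SliceGeneric` at `c` ⟹ `False`.  The repair
  lemma (`PstarChordReads.exists_linear_read_of_chord`) gives a linearly read private; the involution lemmas (`PstarChordReads` for `p`,
  `PstarChordReadsMirror` for `q`) give one of the three kill hypotheses on the slice `(0,0)`.
* `not_sliceGeneric_of_terminal` — contrapositive: in a terminal core every monomial-free chord is slice-DEGENERATE.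

This is a shorter route than the memo's §3 case analysis (no enumeration of annihilator elements); the genericity used is exactly `SliceGeneric`
for the one chord `c` (both values of `t`), nothing about the other chords.  No Assumption A, no peelability.
-/

set_option linter.dupNamespace false -- `Summit.PneNP.PneNP.…`: summit = sub-problem name (D-0017 single-conjunct layout)

open Finset Literature.Computability.Complexity
open scoped symmDiff
open Summit.PneNP.PneNP.Theorems.PstarTyped (Typed)
open Summit.PneNP.PneNP.Theorems.PstarSALevel (varSet bdry BoundaryExpanding SimpleOverlap)
open Summit.PneNP.PneNP.Theorems.PstarGapOneAll (gval)
open Summit.PneNP.PneNP.Theorems.PstarChordRepair (IsChord)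
open Summit.PneNP.PneNP.Theorems.PstarCoreBoundTargets (Terminal)
open Summit.PneNP.PneNP.Theorems.PstarGSat (gSat)
open Summit.PneNP.PneNP.Theorems.PstarGSystemFreeVar (gval_symmDiff)
open Summit.PneNP.PneNP.Theorems.PstarFreshErase (slots_ne)
open Summit.PneNP.PneNP.Theorems.PstarChordReads (exists_linear_read_of_chord gval₂_ne_of_read₁ gval₁_ne_of_read₂ gval_iff_of_read_both)
open Summit.PneNP.PneNP.Theorems.PstarChordReadsMirror

namespace Summit.PneNP.PneNP.Theorems.PstarChordReadLemma

variable {n m : ℕ}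

/-! ## Chord-local readers and slice genericity -/

/-- The reader `(C, G)` is **CHORD-LOCAL** at `c`: its value is a function of `(x_a ⊕ x_b, x_p, x_q)` alone
(`a, b, p, q = vars c 0, 1, 2, 3`). -/
def ChordLocal (I : LocalMap 4 n m) (c : Fin m) (C : Finset (Fin n)) (G : Finset (Fin m)) : Prop :=
  ∃ φ : Bool → Bool → Bool → Bool, ∀ x : Fin n → Bool,
    gval I C G x = φ (xor (x (I.vars c 0)) (x (I.vars c 1))) (x (I.vars c 2)) (x (I.vars c 3))

/-- **SLICE GENERICITY of the chord `c`** (over the fibre values `y`, for the monomial menu `𝒢`): every G-constraint `(C, G)` with `G ⊆ 𝒢` and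
`p, q ∉ C` that misses a target `b` at EVERY solution of `J₀ ∖ c` with `x_a ⊕ x_b = t` is a function of `x_a ⊕ x_b` alone.  The structure-dependent
input of the chord-read lemma (memo §3/§5); certified numerically, not proved. -/
def SliceGeneric (I : LocalMap 4 n m) (y : Fin m → Bool) (J₀ : Finset (Fin m)) (c : Fin m) (𝒢 : Finset (Fin m)) : Prop :=
  ∀ (C : Finset (Fin n)) (G : Finset (Fin m)) (t b : Bool), I.vars c 2 ∉ C → I.vars c 3 ∉ C → G ⊆ 𝒢 →
    (∀ x : Fin n → Bool, (∀ j ∈ J₀.erase c, I.eval x j = y j) → xor (x (I.vars c 0)) (x (I.vars c 1)) = t → gval I C G x ≠ b) →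
    ∃ φ : Bool → Bool, ∀ x : Fin n → Bool, gval I C G x = φ (xor (x (I.vars c 0)) (x (I.vars c 1)))

section Slice

variable {I : LocalMap 4 n m} {y : Fin m → Bool} {J₀ : Finset (Fin m)} {c : Fin m} {𝒢 : Finset (Fin m)}

/-- **SLICE LEMMA.**  A reader with monomials in the menu (avoiding the privates of `c`) that fails on the slice `Sol(J₀) ∩ {x_p = π, x_q = κ}` is
chord-local. -/
theorem chordLocal_of_fail_slice (hI : I.IsPure xorAndPred) (hc : c ∈ J₀) (hch : IsChord I J₀ c) (hgen : SliceGeneric I y J₀ c 𝒢)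
    (hmono : ∀ g ∈ 𝒢, (I.vars g 2 ≠ I.vars c 2 ∧ I.vars g 3 ≠ I.vars c 2) ∧ (I.vars g 2 ≠ I.vars c 3 ∧ I.vars g 3 ≠ I.vars c 3))
    {C : Finset (Fin n)} {G : Finset (Fin m)} (hG : G ⊆ 𝒢) (π κ b : Bool)
    (hfail : ∀ x : Fin n → Bool, (∀ j ∈ J₀, I.eval x j = y j) → x (I.vars c 2) = π → x (I.vars c 3) = κ → gval I C G x ≠ b) :
    ChordLocal I c C G := by
  classical
  have hpp : (I.vars c 2 = I.vars c 2 ∧ I.vars c 3 = I.vars c 3) ∨ (I.vars c 2 = I.vars c 3 ∧ I.vars c 3 = I.vars c 2) := Or.inl ⟨rfl, rfl⟩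
  obtain ⟨-, h0p, h0q, h1p, h1q⟩ := slots_ne hI hpp
  have h23 : I.vars c 2 ≠ I.vars c 3 := fun h => absurd (hI.2 c h) (by decide)
  have hp' : I.vars c 2 ∉ (C.erase (I.vars c 2)).erase (I.vars c 3) := fun h => notMem_erase _ _ (mem_of_mem_erase h)
  have hq' : I.vars c 3 ∉ (C.erase (I.vars c 2)).erase (I.vars c 3) := notMem_erase _ _
  have hmonoG : ∀ g ∈ G, (I.vars g 2 ≠ I.vars c 2 ∧ I.vars g 3 ≠ I.vars c 2) ∧ (I.vars g 2 ≠ I.vars c 3 ∧ I.vars g 3 ≠ I.vars c 3) :=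
    fun g hg => hmono g (hG hg)
  -- the stripped reader fails on the slice `H_{y_c ⊕ πκ}`
  have hfail' : ∀ x : Fin n → Bool, (∀ j ∈ J₀.erase c, I.eval x j = y j) →
      xor (x (I.vars c 0)) (x (I.vars c 1)) = xor (y c) (π && κ) →
      gval I ((C.erase (I.vars c 2)).erase (I.vars c 3)) G x ≠ xor (xor b (decide (I.vars c 2 ∈ C) && π)) (decide (I.vars c 3 ∈ C) && κ) := by
    intro x hx hab hval
    have hab' : xor (xor (x (I.vars c 0)) (x (I.vars c 1))) (π && κ) = y c := by
      rw [hab]; cases y c <;> cases (π && κ) <;> rfl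
    have hsol := solves_set_privates hI hc hch hx π κ hab'
    have hπ : Function.update (Function.update x (I.vars c 2) π) (I.vars c 3) κ (I.vars c 2) = π := by
      rw [Function.update_of_ne h23, Function.update_self]
    have hκ : Function.update (Function.update x (I.vars c 2) π) (I.vars c 3) κ (I.vars c 3) = κ := Function.update_self ..
    refine hfail _ hsol hπ hκ ?_
    rw [gval_eq_split I h23 C G, gval_update_pq I hp' hq' hmonoG x π κ, hval, hπ, hκ]
    cases b <;> cases (decide (I.vars c 2 ∈ C) && π) <;> cases (decide (I.vars c 3 ∈ C) && κ) <;> rfl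
  obtain ⟨φ, hφ⟩ := hgen _ G _ _ hp' hq' hG hfail'
  refine ⟨fun s u v => xor (xor (φ s) (decide (I.vars c 2 ∈ C) && u)) (decide (I.vars c 3 ∈ C) && v), fun x => ?_⟩
  rw [gval_eq_split I h23 C G x, hφ x]

end Slice

section Kills

variable {I : LocalMap 4 n m} {r : ℕ} {y : Fin m → Bool} {J₀ : Finset (Fin m)} {w₁ w₂ : Finset (Fin n) × Finset (Fin m) × Bool} {c : Fin m}

/-- **ENDGAME.**  Two chord-local readers contradict (T3): take the (M0) witness `z` of another output `f ≠ c` (it satisfies the equation of `c`),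
a solution of `J₀ ∖ c` with the same `x_a ⊕ x_b` (`gSat` on the pair read), and set its privates to `(z_p, z_q)`. -/
theorem false_of_chordLocal (hI : I.IsPure xorAndPred) (hT : Typed I) (hS : SimpleOverlap I) (hB : BoundaryExpanding r I)
    (ht : Terminal I r y J₀ w₁ w₂) (hc : c ∈ J₀) (hch : IsChord I J₀ c) (h₁ : ChordLocal I c w₁.1 w₁.2.1) (h₂ : ChordLocal I c w₂.1 w₂.2.1) :
    False := by
  classical
  obtain ⟨φ₁, hφ₁⟩ := h₁
  obtain ⟨φ₂, hφ₂⟩ := h₂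
  have hpp : (I.vars c 2 = I.vars c 2 ∧ I.vars c 3 = I.vars c 3) ∨ (I.vars c 2 = I.vars c 3 ∧ I.vars c 3 = I.vars c 2) := Or.inl ⟨rfl, rfl⟩
  obtain ⟨h01, h0p, h0q, h1p, h1q⟩ := slots_ne hI hpp
  have h23 : I.vars c 2 ≠ I.vars c 3 := fun h => absurd (hI.2 c h) (by decide)
  obtain ⟨f, hf, hfc⟩ := exists_ne_of_xorClosed ht.2.1 hc
  obtain ⟨z, hz, hz₁, hz₂⟩ := ht.2.2.2.2.2.2.2 f hf
  have hzc : I.eval z c = y c := hz c (mem_erase.2 ⟨hfc.symm, hc⟩)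
  -- a solution of `J₀ ∖ c` with the witness's `x_a ⊕ x_b`
  have hJr' : (J₀.erase c).card ≤ r := (card_le_card (erase_subset c J₀)).trans ht.2.2.1.le
  have hnc : ∃ u u' : Fin n → Bool, gval I {I.vars c 0, I.vars c 1} ∅ u ≠ gval I {I.vars c 0, I.vars c 1} ∅ u' := by
    refine ⟨fun v => decide (v = I.vars c 0), fun _ => false, ?_⟩
    rw [gval_pair I h01, gval_pair I h01]
    simp [h01.symm]
  obtain ⟨x, hx, hxab⟩ := gSat n m r I hI hT hB hS y (J₀.erase c) ∅ {I.vars c 0, I.vars c 1}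
    (xor (z (I.vars c 0)) (z (I.vars c 1))) hJr' (disjoint_empty_right _) hnc
  rw [gval_pair I h01] at hxab
  have hzab := xor_eq_of_eval hI hzc
  have hab : xor (xor (x (I.vars c 0)) (x (I.vars c 1))) (z (I.vars c 2) && z (I.vars c 3)) = y c := by
    rw [hxab, hzab]; cases y c <;> cases (z (I.vars c 2) && z (I.vars c 3)) <;> rfl
  have hsol := solves_set_privates hI hc hch hx _ _ hab
  -- the readers there take the witness's values
  have key : ∀ (φ : Bool → Bool → Bool → Bool) (C : Finset (Fin n)) (G : Finset (Fin m)),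
      (∀ x, gval I C G x = φ (xor (x (I.vars c 0)) (x (I.vars c 1))) (x (I.vars c 2)) (x (I.vars c 3))) →
      gval I C G (Function.update (Function.update x (I.vars c 2) (z (I.vars c 2))) (I.vars c 3) (z (I.vars c 3))) = gval I C G z := by
    intro φ C G hφ
    rw [hφ, hφ z, Function.update_self, Function.update_of_ne h23, Function.update_self, Function.update_of_ne h0q,
      Function.update_of_ne h0p, Function.update_of_ne h1q, Function.update_of_ne h1p, hxab]
  refine ht.2.2.2.2.2.2.1 ⟨_, hsol, ?_, ?_⟩
  · rw [key φ₁ _ _ hφ₁]; exact hz₁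
  · rw [key φ₂ _ _ hφ₂]; exact hz₂

/-- `G₁ ∆ G₂ ⊆ G₁ ∪ G₂`. -/
private theorem symmDiff_subset_union' (G₁ G₂ : Finset (Fin m)) : G₁ ∆ G₂ ⊆ G₁ ∪ G₂ := fun g hg => by
  rcases Finset.mem_symmDiff.1 hg with ⟨h, -⟩ | ⟨h, -⟩
  · exact mem_union_left _ h
  · exact mem_union_right _ h

/-- **KILL (i): `Γ₂` fails on a slice.**  Then `Γ₂` is chord-local; (T3) makes `Γ₁` fail on any slice where `Γ₂` holds (so `Γ₁` is chord-local
too — endgame), and if `Γ₂` holds on no slice it fails at the (M0) witness of another output. -/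
theorem false_of_fail₂ (hI : I.IsPure xorAndPred) (hT : Typed I) (hS : SimpleOverlap I) (hB : BoundaryExpanding r I)
    (ht : Terminal I r y J₀ w₁ w₂) (hc : c ∈ J₀) (hch : IsChord I J₀ c)
    (hmono : ∀ g ∈ w₁.2.1 ∪ w₂.2.1, (I.vars g 2 ≠ I.vars c 2 ∧ I.vars g 3 ≠ I.vars c 2) ∧ (I.vars g 2 ≠ I.vars c 3 ∧ I.vars g 3 ≠ I.vars c 3))
    (hgen : SliceGeneric I y J₀ c (w₁.2.1 ∪ w₂.2.1)) (π₀ κ₀ : Bool)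
    (hfail : ∀ x : Fin n → Bool, (∀ j ∈ J₀, I.eval x j = y j) → x (I.vars c 2) = π₀ → x (I.vars c 3) = κ₀ →
      gval I w₂.1 w₂.2.1 x ≠ w₂.2.2) : False := by
  have h₂ := chordLocal_of_fail_slice hI hc hch hgen hmono subset_union_right π₀ κ₀ w₂.2.2 hfail
  obtain ⟨φ₂, hφ₂⟩ := id h₂
  by_cases H : ∃ π κ : Bool, φ₂ (xor (y c) (π && κ)) π κ = w₂.2.2
  · obtain ⟨π, κ, hπκ⟩ := H
    have h₁ : ChordLocal I c w₁.1 w₁.2.1 := by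
      refine chordLocal_of_fail_slice hI hc hch hgen hmono subset_union_left π κ w₁.2.2 fun x hx hp hq h₁ => ?_
      refine ht.2.2.2.2.2.2.1 ⟨x, hx, h₁, ?_⟩
      rw [hφ₂ x, xor_eq_of_eval hI (hx c hc), hp, hq]
      exact hπκ
    exact false_of_chordLocal hI hT hS hB ht hc hch h₁ h₂
  · push Not at H
    obtain ⟨f, hf, hfc⟩ := exists_ne_of_xorClosed ht.2.1 hc
    obtain ⟨z, hz, -, hz₂⟩ := ht.2.2.2.2.2.2.2 f hf
    have hzc : I.eval z c = y c := hz c (mem_erase.2 ⟨hfc.symm, hc⟩)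
    rw [hφ₂ z, xor_eq_of_eval hI hzc] at hz₂
    exact H _ _ hz₂

/-- **KILL (ii): `Γ₁` fails on a slice** (KILL (i) for the swapped pair of readers). -/
theorem false_of_fail₁ (hI : I.IsPure xorAndPred) (hT : Typed I) (hS : SimpleOverlap I) (hB : BoundaryExpanding r I)
    (ht : Terminal I r y J₀ w₁ w₂) (hc : c ∈ J₀) (hch : IsChord I J₀ c)
    (hmono : ∀ g ∈ w₁.2.1 ∪ w₂.2.1, (I.vars g 2 ≠ I.vars c 2 ∧ I.vars g 3 ≠ I.vars c 2) ∧ (I.vars g 2 ≠ I.vars c 3 ∧ I.vars g 3 ≠ I.vars c 3))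
    (hgen : SliceGeneric I y J₀ c (w₁.2.1 ∪ w₂.2.1)) (π₀ κ₀ : Bool)
    (hfail : ∀ x : Fin n → Bool, (∀ j ∈ J₀, I.eval x j = y j) → x (I.vars c 2) = π₀ → x (I.vars c 3) = κ₀ →
      gval I w₁.1 w₁.2.1 x ≠ w₁.2.2) : False := by
  have hmono' : ∀ g ∈ w₂.2.1 ∪ w₁.2.1, (I.vars g 2 ≠ I.vars c 2 ∧ I.vars g 3 ≠ I.vars c 2) ∧
      (I.vars g 2 ≠ I.vars c 3 ∧ I.vars g 3 ≠ I.vars c 3) := fun g hg => hmono g (by rwa [union_comm])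
  have hgen' : SliceGeneric I y J₀ c (w₂.2.1 ∪ w₁.2.1) := by rwa [union_comm]
  exact false_of_fail₂ hI hT hS hB (terminal_swap ht) hc hch hmono' hgen' π₀ κ₀ hfail

/-- **KILL (iii): the readers are complementary on a slice.**  Then the SUM reader `(C₁ ∆ C₂, G₁ ∆ G₂)` fails there, so it is chord-local:
`Γ₂ = Γ₁ ⊕ φ(x_a ⊕ x_b, x_p, x_q)`; (T3) makes `Γ₁` fail on any slice where `φ = b₁ ⊕ b₂` (then both readers are chord-local — endgame), and if
there is no such slice the (M0) witness of another output is contradictory. -/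
theorem false_of_iff (hI : I.IsPure xorAndPred) (hT : Typed I) (hS : SimpleOverlap I) (hB : BoundaryExpanding r I)
    (ht : Terminal I r y J₀ w₁ w₂) (hc : c ∈ J₀) (hch : IsChord I J₀ c)
    (hmono : ∀ g ∈ w₁.2.1 ∪ w₂.2.1, (I.vars g 2 ≠ I.vars c 2 ∧ I.vars g 3 ≠ I.vars c 2) ∧ (I.vars g 2 ≠ I.vars c 3 ∧ I.vars g 3 ≠ I.vars c 3))
    (hgen : SliceGeneric I y J₀ c (w₁.2.1 ∪ w₂.2.1)) (π₀ κ₀ : Bool)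
    (hiff : ∀ x : Fin n → Bool, (∀ j ∈ J₀, I.eval x j = y j) → x (I.vars c 2) = π₀ → x (I.vars c 3) = κ₀ →
      (gval I w₁.1 w₁.2.1 x = w₁.2.2 ↔ gval I w₂.1 w₂.2.1 x ≠ w₂.2.2)) : False := by
  -- the sum reader fails on the slice
  have hsum : ChordLocal I c (w₁.1 ∆ w₂.1) (w₁.2.1 ∆ w₂.2.1) := by
    refine chordLocal_of_fail_slice hI hc hch hgen hmono (symmDiff_subset_union' _ _) π₀ κ₀ (xor w₁.2.2 w₂.2.2) fun x hx hp hq h => ?_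
    rw [gval_symmDiff] at h
    have := hiff x hx hp hq
    revert this h
    cases gval I w₁.1 w₁.2.1 x <;> cases gval I w₂.1 w₂.2.1 x <;> cases w₁.2.2 <;> cases w₂.2.2 <;> decide
  obtain ⟨φ, hφ⟩ := hsum
  have hrel : ∀ x : Fin n → Bool,
      gval I w₂.1 w₂.2.1 x = xor (gval I w₁.1 w₁.2.1 x) (φ (xor (x (I.vars c 0)) (x (I.vars c 1))) (x (I.vars c 2)) (x (I.vars c 3))) := by
    intro x
    have h := hφ x
    rw [gval_symmDiff] at h
    revert h
    generalize φ (xor (x (I.vars c 0)) (x (I.vars c 1))) (x (I.vars c 2)) (x (I.vars c 3)) = e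
    cases gval I w₁.1 w₁.2.1 x <;> cases gval I w₂.1 w₂.2.1 x <;> cases e <;> decide
  by_cases H : ∃ π κ : Bool, φ (xor (y c) (π && κ)) π κ = xor w₁.2.2 w₂.2.2
  · obtain ⟨π, κ, hπκ⟩ := H
    have h₁ : ChordLocal I c w₁.1 w₁.2.1 := by
      refine chordLocal_of_fail_slice hI hc hch hgen hmono subset_union_left π κ w₁.2.2 fun x hx hp hq h₁ => ?_
      refine ht.2.2.2.2.2.2.1 ⟨x, hx, h₁, ?_⟩
      rw [hrel x, h₁, xor_eq_of_eval hI (hx c hc), hp, hq, hπκ]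
      cases w₁.2.2 <;> cases w₂.2.2 <;> rfl
    obtain ⟨φ₁, hφ₁⟩ := id h₁
    have h₂ : ChordLocal I c w₂.1 w₂.2.1 := ⟨fun s u v => xor (φ₁ s u v) (φ s u v), fun x => by rw [hrel x, hφ₁ x]⟩
    exact false_of_chordLocal hI hT hS hB ht hc hch h₁ h₂
  · push Not at H
    obtain ⟨f, hf, hfc⟩ := exists_ne_of_xorClosed ht.2.1 hc
    obtain ⟨z, hz, hz₁, hz₂⟩ := ht.2.2.2.2.2.2.2 f hf
    have hzc : I.eval z c = y c := hz c (mem_erase.2 ⟨hfc.symm, hc⟩)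
    have h := hrel z
    rw [hz₁, hz₂, xor_eq_of_eval hI hzc] at h
    apply H (z (I.vars c 2)) (z (I.vars c 3))
    revert h
    generalize φ (xor (y c) (z (I.vars c 2) && z (I.vars c 3))) (z (I.vars c 2)) (z (I.vars c 3)) = e
    cases w₁.2.2 <;> cases w₂.2.2 <;> cases e <;> decide

end Kills

/-! ## The chord-read lemma -/

/-- **THE CHORD-READ LEMMA** (memo §3, kernel form).  On a pure typed `(r,3/2)`-expanding instance with simple overlaps, a TERMINAL core has no
MONOMIAL-FREE chord that is SLICE-GENERIC: the repair lemma gives a linearly read private, the involution lemma on it gives one of the three kill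
hypotheses on the slice `x_p = x_q = 0`, and the kills close.  No Assumption A, no peelability; the only structure-dependent input is
`SliceGeneric` at the one chord `c`. -/
theorem false_of_monomial_free_chord (I : LocalMap 4 n m) (hI : I.IsPure xorAndPred) (hT : Typed I) (hS : SimpleOverlap I) {r : ℕ}
    (hB : BoundaryExpanding r I) {y : Fin m → Bool} {J₀ : Finset (Fin m)} {w₁ w₂ : Finset (Fin n) × Finset (Fin m) × Bool}
    (ht : Terminal I r y J₀ w₁ w₂) {c : Fin m} (hc : c ∈ J₀) (hch : IsChord I J₀ c)
    (hmono : ∀ g ∈ w₁.2.1 ∪ w₂.2.1, (I.vars g 2 ≠ I.vars c 2 ∧ I.vars g 3 ≠ I.vars c 2) ∧ (I.vars g 2 ≠ I.vars c 3 ∧ I.vars g 3 ≠ I.vars c 3))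
    (hgen : SliceGeneric I y J₀ c (w₁.2.1 ∪ w₂.2.1)) : False := by
  have hmono₂ : ∀ g ∈ w₁.2.1 ∪ w₂.2.1, I.vars g 2 ≠ I.vars c 2 ∧ I.vars g 3 ≠ I.vars c 2 := fun g hg => (hmono g hg).1
  have hmono₃ : ∀ g ∈ w₁.2.1 ∪ w₂.2.1, I.vars g 2 ≠ I.vars c 3 ∧ I.vars g 3 ≠ I.vars c 3 := fun g hg => (hmono g hg).2
  rcases exists_linear_read_of_chord hI ht hc hch hmono with hp | hq
  · -- the private `p` is read linearly: involution at `x_q = 0`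
    by_cases hp₁ : I.vars c 2 ∈ w₁.1 <;> by_cases hp₂ : I.vars c 2 ∈ w₂.1
    · exact false_of_iff hI hT hS hB ht hc hch hmono hgen false false
        fun x hx _ hq => gval_iff_of_read_both hI ht hc hch hmono₂ hp₁ hp₂ hx hq
    · exact false_of_fail₂ hI hT hS hB ht hc hch hmono hgen false false
        fun x hx _ hq => gval₂_ne_of_read₁ hI ht hc hch hmono₂ hp₁ hp₂ hx hq
    · exact false_of_fail₁ hI hT hS hB ht hc hch hmono hgen false false
        fun x hx _ hq => gval₁_ne_of_read₂ hI ht hc hch hmono₂ hp₁ hp₂ hx hq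
    · exact absurd hp (by rw [mem_union, not_or]; exact ⟨hp₁, hp₂⟩)
  · -- the private `q` is read linearly: involution at `x_p = 0`
    by_cases hq₁ : I.vars c 3 ∈ w₁.1 <;> by_cases hq₂ : I.vars c 3 ∈ w₂.1
    · exact false_of_iff hI hT hS hB ht hc hch hmono hgen false false
        fun x hx hp _ => gval_iff_of_read_both₃ hI ht hc hch hmono₃ hq₁ hq₂ hx hp
    · exact false_of_fail₂ hI hT hS hB ht hc hch hmono hgen false false
        fun x hx hp _ => gval₂_ne_of_read₁₃ hI ht hc hch hmono₃ hq₁ hq₂ hx hp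
    · exact false_of_fail₁ hI hT hS hB ht hc hch hmono hgen false false
        fun x hx hp _ => gval₁_ne_of_read₂₃ hI ht hc hch hmono₃ hq₁ hq₂ hx hp
    · exact absurd hq (by rw [mem_union, not_or]; exact ⟨hq₁, hq₂⟩)

/-- **Contrapositive: in a terminal core every monomial-free chord is slice-degenerate** — the form the per-structure certificate contradicts
(memo §6.6: in class LIN every tight `k = 12` O1 structure has, for every `y`, a slice-generic chord, and all six chords are monomial-free). -/
theorem not_sliceGeneric_of_terminal (I : LocalMap 4 n m) (hI : I.IsPure xorAndPred) (hT : Typed I) (hS : SimpleOverlap I) {r : ℕ}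
    (hB : BoundaryExpanding r I) {y : Fin m → Bool} {J₀ : Finset (Fin m)} {w₁ w₂ : Finset (Fin n) × Finset (Fin m) × Bool}
    (ht : Terminal I r y J₀ w₁ w₂) {c : Fin m} (hc : c ∈ J₀) (hch : IsChord I J₀ c)
    (hmono : ∀ g ∈ w₁.2.1 ∪ w₂.2.1, (I.vars g 2 ≠ I.vars c 2 ∧ I.vars g 3 ≠ I.vars c 2) ∧ (I.vars g 2 ≠ I.vars c 3 ∧ I.vars g 3 ≠ I.vars c 3)) :
    ¬ SliceGeneric I y J₀ c (w₁.2.1 ∪ w₂.2.1) :=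
  fun hgen => false_of_monomial_free_chord I hI hT hS hB ht hc hch hmono hgen

end Summit.PneNP.PneNP.Theorems.PstarChordReadLemma
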